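import Summits.AtomisticToContinuum.FouriersLaw.Theorems.ConductanceLowerBound.Negative.HarmonicCornerLowerBound

/-!
# `NonBallistic` / Negative: the statement is false without anharmonicity

Hypothesis-mutation record for crux `stmt-AtomisticToContinuum-9127`
(`JunctionLocality.NonBallistic`, shared verbatim with `PuiseuxTransferLedger.NonBallistic` and
`BondHeatUncertainty.NonBallistic`), crux-disprover generation 2 (2026-08-16), `Disproof.lean` §4.
The strict inequalities `0 < lam`, `0 < β` ARE load-bearing: relaxing them to `0 ≤ lam`, `0 ≤ β`
admits the pinned HARMONIC member `pinnedChain ω₂ 0 0 γ`, which is ballistic — along its Gaussian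
steady-state family the response coefficients are `D_{M+1} = M c_{M+1}` with `c_N → c_∞ > 0`
(Rieder–Lebowitz–Lieb / Nakazawa / Roy–Dhar; landed as `conductanceLowerBound_harmonic_corner`),
so the conclusion `∀ ε > 0 ∀ N₀ ∃ N ≥ N₀, D_N ≤ ε (N - 1)` fails.  Two records:
(1) with the weak-uniqueness hypothesis dropped the relaxed statement is false outright;
(2) keeping the crux's exact shape (uniqueness hypothesis in place), the relaxed statement is
false MODULO weak-NESS uniqueness of the harmonic chain (true in print for the controllable
Ornstein–Uhlenbeck process, not in tree).  Any proof of the crux must use `lam > 0 ∨ β > 0`.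
Nothing here closes an item.
-/

noncomputable section

namespace Summit.AtomisticToContinuum.FouriersLaw.Theorems

open MeasureTheory Filter Topology
open Literature.MathematicalPhysics.KineticTheory.HeatConduction

/-- **`NonBallistic` is false without anharmonicity** (uniqueness hypothesis dropped): the
variant over `0 ≤ lam`, `0 ≤ β`, asked along every steady-state family, fails at
`pinnedChain 1 0 0 1`, `T = 1`. [folklore] -/
theorem nonBallistic_false_without_anharmonicity :
    ¬ (∀ ω₂ lam β γ : ℝ, 0 < ω₂ → 0 ≤ lam → 0 ≤ β → 0 < γ →
        ∀ μ : (N : ℕ) → ℝ → ℝ → Measure (PhaseSpace N),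
          (∀ (N : ℕ) (T_L T_R : ℝ), 0 < T_L → 0 < T_R →
            (pinnedChain ω₂ lam β γ).IsSteadyState N T_L T_R (μ N T_L T_R)) →
          ∀ T : ℝ, 0 < T → ∀ D : ℕ → ℝ,
            (∀ N : ℕ, Tendsto (fun δ : ℝ =>
              (pinnedChain ω₂ lam β γ).totalCurrent (μ N (T + δ / 2) (T - δ / 2)) / δ)
              (𝓝[≠] 0) (𝓝 (D N))) →
            ∀ ε : ℝ, 0 < ε → ∀ N₀ : ℕ, ∃ N : ℕ, N₀ ≤ N ∧ D N ≤ ε * ((N : ℝ) - 1)) := by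
  intro h
  obtain ⟨μ, hμ, hT⟩ := conductanceLowerBound_harmonic_corner one_pos one_pos
  obtain ⟨D, hD, -, -, hnot⟩ := hT 1 one_pos
  exact hnot (h 1 0 0 1 one_pos le_rfl le_rfl one_pos μ hμ 1 one_pos D hD)

/-- **The crux's exact shape dies at the harmonic corner, modulo harmonic weak uniqueness.**
If the weak steady states (`IsSteadyState` class) of the pinned harmonic chain
`pinnedChain ω₂ 0 0 γ` are unique at all lengths and positive bath temperatures, then the
statement `NonBallistic` with `0 < lam → 0 < β →` relaxed to `0 ≤ lam → 0 ≤ β →` (uniqueness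
hypothesis kept) is false. [folklore] -/
theorem nonBallistic_closedRange_false_of_harmonic_unique {ω₂ γ : ℝ} (hω : 0 < ω₂) (hγ : 0 < γ)
    (hU : ∀ (N : ℕ) (T_L T_R : ℝ), 0 < T_L → 0 < T_R → ∀ μ ν : Measure (PhaseSpace N),
      (pinnedChain ω₂ 0 0 γ).IsSteadyState N T_L T_R μ →
      (pinnedChain ω₂ 0 0 γ).IsSteadyState N T_L T_R ν → μ = ν) :
    ¬ (∀ ω₂ lam β γ : ℝ, 0 < ω₂ → 0 ≤ lam → 0 ≤ β → 0 < γ →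
        (∀ (N : ℕ) (T_L T_R : ℝ), 0 < T_L → 0 < T_R → ∀ μ ν : Measure (PhaseSpace N),
          (pinnedChain ω₂ lam β γ).IsSteadyState N T_L T_R μ →
          (pinnedChain ω₂ lam β γ).IsSteadyState N T_L T_R ν → μ = ν) →
        ∀ μ : (N : ℕ) → ℝ → ℝ → Measure (PhaseSpace N),
          (∀ (N : ℕ) (T_L T_R : ℝ), 0 < T_L → 0 < T_R →
            (pinnedChain ω₂ lam β γ).IsSteadyState N T_L T_R (μ N T_L T_R)) →
          ∀ T : ℝ, 0 < T → ∀ D : ℕ → ℝ,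
            (∀ N : ℕ, Tendsto (fun δ : ℝ =>
              (pinnedChain ω₂ lam β γ).totalCurrent (μ N (T + δ / 2) (T - δ / 2)) / δ)
              (𝓝[≠] 0) (𝓝 (D N))) →
            ∀ ε : ℝ, 0 < ε → ∀ N₀ : ℕ, ∃ N : ℕ, N₀ ≤ N ∧ D N ≤ ε * ((N : ℝ) - 1)) := by
  intro h
  obtain ⟨μ, hμ, hT⟩ := conductanceLowerBound_harmonic_corner hω hγ
  obtain ⟨D, hD, -, -, hnot⟩ := hT 1 one_pos
  exact hnot (h ω₂ 0 0 γ hω le_rfl le_rfl hγ hU μ hμ 1 one_pos D hD)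

end Summit.AtomisticToContinuum.FouriersLaw.Theorems

end
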